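import Summits.QuantumFields.BalabanUV.Beta.RootedMixedChartReflection

/-!
# `BalabanUV.Beta.RootedMixedJetLinear` — LINEARITY AND `Tau`-CENTRALITY OF THE ROOTED MIXED JET IN THE BACKGROUND LETTER
# on leaf-05's mixed left chart with general background (`GmL`∕`GmbL`∕`PhiMLAt`∕`MjetLAt`), hence of node 12b's `MjetAt` in `B`
# (β sub-cell, row D1 letter chain HR-W-LET, MIXED sub-chain toward the level-0 mixed identity (M₀); an3 gen 33, an1 first refusal)

HONEST FRAMING (cell charter, verbatim): «discharging BetaPertH makes Bałaban's UV stability UNCONDITIONAL — a real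
constructive-QFT result; it is NOT the continuum limit and NOT the Clay problem.»  HONEST DEPENDENCY (verbatim): «continuum YM on
T⁴ ⇐ BetaPertH ∧ nine spine estimates (0/9 proved); BetaPertH ⇐ (D1) ∧ (D4) ∧ CAP+tail; G-an2-4 gates asym, D1 and NE2/3/4.»
DERIVED cell leaf: [folklore] ring algebra — node 12's naturality proofs (`scaleDual`, `mergeDual`, `map_PhiGAt`, `map_logT`,
`map_invT`) transported to the rooted MIXED jet on leaf-05-g7's general-background mixed chart (`RootedMixedChartReflection` p223350, BY NAME).
No statement of Bałaban's papers is typed here, no `[cite:]` tag, no `Prop` is minted, no binder of the β-function wall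
(`hW`/`hR`/`D1Tel`/`D1Rep`, (D1), `BetaPertH`) is instantiated or discharged.  NOT summit progress.

## What this module proves

For FIXED fluctuation letter pairs `(Z, Z̄′)` (numerator) and `(Z₀, Z̄₀)` (reference) and `Tau`-valued background letters `b` (numerator), `c`
(reference):
* §0 the `Tau`-valued TWO-BACKGROUND σ-jet `MσGAt ρ Z Z̄′ b Z₀ Z̄₀ c := (logT (Φ^L(Z, Z̄′, b) · invT Φ^L(Z₀, Z̄₀, c))).snd`; leaf-05's
  common-background σ-jet `MσLAt … b` IS its diagonal `c = b` and `MjetLAt = c11 ∘ MσLAt` (both `rfl`);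
* §1 CENTRALITY `MσGAt … (s·b) … (s·c) = s · MσGAt … b … c` for central `s ∈ Tau 𝔸` (`MσGAt_mul_central`, `MσLAt_mul_central`; `τ₁`, `τ₂`,
  `τ₁τ₂`, scalars), hence `MjetLAt … (τ₁·b) = c01 (MσLAt … b)`, `(τ₂·b) ↦ c10`, `(τ₁τ₂·b) ↦ c00` (`MjetLAt_τ₁_mul` etc.);
* §2 JOINT ADDITIVITY `MσGAt … (b₁ + b₂) … (c₁ + c₂) = MσGAt … b₁ … c₁ + MσGAt … b₂ … c₂` (`MσGAt_add₂`), in particular the REFERENCE SHIFT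
  `MσGAt … (c + D) … c = MσLAt … c + MσGAt … D … 0` (`MσGAt_eq_MσLAt_add`: a background correction `D` in the numerator only contributes its
  UN-NORMALISED σ-jet), and `MσLAt_add` (`_zero`, `_neg`, `_sub`, `_sum`), the same for `MjetLAt`;
* §3 node 12b's instance: `MjetAt ρ W V (B₁ + B₂) = MjetAt ρ W V B₁ + MjetAt ρ W V B₂` (`MjetAt_add_B`, `_neg_B`, `_sub_B`, `_sum_B`).

## What is NOT here
No reflection law, no `Ad`-expansion of the reflected background `BR`, no table: these are the linear-algebra prerequisites for
expanding leaf-05's reflected mixed background letter `BR` (Tau-valued on the axis) by components.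
-/

namespace Summit.QuantumFields.BalabanUV.Beta.RootedMixedJetLinear

open Literature.MathematicalPhysics.QuantumFieldTheory.Balaban1983to89
open Literature.MathematicalPhysics.QuantumFieldTheory.Balaban1983to89.Beta
open AffineAveraging (Form1)
open AveragingThirdJet (Tau Rho dmk fst_dmk snd_dmk dfst_mul dsnd_mul mapDual fst_mapDual snd_mapDual scaleDual fst_scaleDual
  snd_scaleDual mergeDual fst_mergeDual snd_mergeDual upF upF_apply logT invT map_logT map_invT)
open AveragingThirdJet.Tau (τ₁ τ₂ τ12 ι c00 c10 c01 c11 c11_add c11_neg c11_smul c11_τ₁_mul c11_τ₂_mul c11_τ12_mul τ₁_comm τ₂_comm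
  τ12_comm ext4)
open AveragingMixedJetTables (PhiGAt map_PhiGAt Zf Zb MjetAt)
open Summit.QuantumFields.BalabanUV.Beta.RootedMixedChartReflection (GmL GmbL PhiMLAt MσLAt MjetLAt fst_GmL snd_GmL fst_GmbL
  snd_GmbL MjetAt_eq_MjetLAt)

variable (𝕜 : Type*) [Field 𝕜] {d : ℕ} {𝔸 : Type*} [Ring 𝔸] [Algebra 𝕜 𝔸]

/-! ## §0 The `Tau`-valued σ-jets -/

/-- [folklore] THE `Tau`-VALUED TWO-BACKGROUND σ-JET of the mixed left chart: the σ-coefficient of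
`logT (Φ^L(Z, Z̄′, b) · invT Φ^L(Z₀, Z̄₀, c))` — numerator background `b`, reference pair `(Z₀, Z̄₀)` at reference background `c`. -/
noncomputable def MσGAt (ρ : Fin d → ℤ) (Z Zb' b Z₀ Zb₀ c : Form1 d (Tau 𝔸)) (L : ℕ) (μ : Fin d) (y : Fin d → ℤ) : Tau 𝔸 :=
  (logT 𝕜 (PhiMLAt 𝕜 ρ Z Zb' b L μ y * invT (PhiMLAt 𝕜 ρ Z₀ Zb₀ c L μ y))).snd

variable {𝕜}

/-- [folklore] BRIDGE: leaf-05's common-background σ-jet `MσLAt` is the diagonal `c = b` of `MσGAt`. -/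
theorem MσLAt_eq_MσGAt (ρ : Fin d → ℤ) (Z Zb' Z₀ Zb₀ b : Form1 d (Tau 𝔸)) (L : ℕ) (μ : Fin d) (y : Fin d → ℤ) :
    MσLAt 𝕜 ρ Z Zb' Z₀ Zb₀ b L μ y = MσGAt 𝕜 ρ Z Zb' b Z₀ Zb₀ b L μ y := rfl

/-- [folklore] BRIDGE: `MjetLAt = c11 ∘ MσLAt` (leaf-05's `MjetLAt_eq_c11`, restated for the local rewriting chains). -/
theorem MjetLAt_eq_c11_MσLAt (ρ : Fin d → ℤ) (Z Zb' Z₀ Zb₀ b : Form1 d (Tau 𝔸)) (L : ℕ) (μ : Fin d) (y : Fin d → ℤ) :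
    MjetLAt 𝕜 ρ Z Zb' Z₀ Zb₀ b L μ y = c11 (MσLAt 𝕜 ρ Z Zb' Z₀ Zb₀ b L μ y) := rfl

/-- [folklore] The un-normalised σ-jet (reference background `0`) is the σ-component of `logT (Φ^L(Z, Z̄′, b) · invT Φ^L(Z₀, Z̄₀, 0))`;
at the trivial reference pair `Z₀ = Z̄₀ = 1` it is the σ-component of `logT Φ^L(Z, Z̄′, b)` (`MσGAt_one_one_zero`). -/
theorem MσGAt_one_one_zero (ρ : Fin d → ℤ) (Z Zb' b : Form1 d (Tau 𝔸)) (L : ℕ) (μ : Fin d) (y : Fin d → ℤ) :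
    MσGAt 𝕜 ρ Z Zb' b (fun _ _ => 1) (fun _ _ => 1) 0 L μ y = (logT 𝕜 (PhiMLAt 𝕜 ρ Z Zb' b L μ y)).snd := by
  have h1 : GmL (fun _ _ => (1 : Tau 𝔸)) (0 : Form1 d (Tau 𝔸)) = fun _ _ => 1 := by
    funext κ x; exact TrivSqZeroExt.ext (by simp) (by simp)
  have h1b : GmbL (fun _ _ => (1 : Tau 𝔸)) (0 : Form1 d (Tau 𝔸)) = fun _ _ => 1 := by
    funext κ x; exact TrivSqZeroExt.ext (by simp) (by simp)
  rw [MσGAt, PhiMLAt, PhiMLAt, h1, h1b, AveragingMixedJetTables.PhiGAt_one, AveragingThirdJet.invT_one, mul_one]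

/-! ## §1 Centrality -/

/-- [folklore] HOMOGENEITY of the two-background σ-jet under CENTRAL elements of `Tau 𝔸` multiplying BOTH background letters. -/
theorem MσGAt_mul_central (s : Tau 𝔸) (hs : ∀ t, s * t = t * s) (ρ : Fin d → ℤ) (Z Zb' b Z₀ Zb₀ c : Form1 d (Tau 𝔸)) (L : ℕ)
    (μ : Fin d) (y : Fin d → ℤ) :
    MσGAt 𝕜 ρ Z Zb' (fun κ x => s * b κ x) Z₀ Zb₀ (fun κ x => s * c κ x) L μ y = s * MσGAt 𝕜 ρ Z Zb' b Z₀ Zb₀ c L μ y := by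
  have hG : ∀ (Z b : Form1 d (Tau 𝔸)) κ x, scaleDual (𝕜 := 𝕜) s hs (GmL Z b κ x) = GmL Z (fun κ x => s * b κ x) κ x :=
    fun Z b κ x => TrivSqZeroExt.ext (by simp) (by rw [snd_scaleDual, snd_GmL, snd_GmL, ← mul_assoc, hs, mul_assoc])
  have hGb : ∀ (Zb' b : Form1 d (Tau 𝔸)) κ x, scaleDual (𝕜 := 𝕜) s hs (GmbL Zb' b κ x) = GmbL Zb' (fun κ x => s * b κ x) κ x :=
    fun Zb' b κ x => TrivSqZeroExt.ext (by simp) (by rw [snd_scaleDual, snd_GmbL, snd_GmbL, mul_neg, mul_assoc])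
  unfold MσGAt PhiMLAt
  have key := congrArg TrivSqZeroExt.snd (map_logT (scaleDual (𝕜 := 𝕜) s hs)
    (PhiGAt 𝕜 ρ (GmL Z b) (GmbL Zb' b) L μ y * invT (PhiGAt 𝕜 ρ (GmL Z₀ c) (GmbL Zb₀ c) L μ y)))
  simp only [map_mul, map_invT, map_PhiGAt, hG, hGb, snd_scaleDual] at key
  exact key.symm

/-- [folklore] HOMOGENEITY of the common-background σ-jet under CENTRAL elements of `Tau 𝔸`. -/
theorem MσLAt_mul_central (s : Tau 𝔸) (hs : ∀ t, s * t = t * s) (ρ : Fin d → ℤ) (Z Zb' Z₀ Zb₀ b : Form1 d (Tau 𝔸)) (L : ℕ)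
    (μ : Fin d) (y : Fin d → ℤ) :
    MσLAt 𝕜 ρ Z Zb' Z₀ Zb₀ (fun κ x => s * b κ x) L μ y = s * MσLAt 𝕜 ρ Z Zb' Z₀ Zb₀ b L μ y := by
  rw [MσLAt_eq_MσGAt, MσLAt_eq_MσGAt]; exact MσGAt_mul_central s hs ρ Z Zb' b Z₀ Zb₀ b L μ y

/-- [folklore] … for the un-normalised jet (reference background `0`). -/
theorem MσGAt_mul_central_zero (s : Tau 𝔸) (hs : ∀ t, s * t = t * s) (ρ : Fin d → ℤ) (Z Zb' b Z₀ Zb₀ : Form1 d (Tau 𝔸)) (L : ℕ)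
    (μ : Fin d) (y : Fin d → ℤ) :
    MσGAt 𝕜 ρ Z Zb' (fun κ x => s * b κ x) Z₀ Zb₀ 0 L μ y = s * MσGAt 𝕜 ρ Z Zb' b Z₀ Zb₀ 0 L μ y := by
  have h := MσGAt_mul_central (𝕜 := 𝕜) s hs ρ Z Zb' b Z₀ Zb₀ 0 L μ y
  simp only [Pi.zero_apply, mul_zero] at h
  exact h

/-- [folklore] … for `τ₁`, at the level of the `τ₁τ₂`-component: `Mjet(τ₁·b) = c01 Mσ(b)`. -/
theorem MjetLAt_τ₁_mul (ρ : Fin d → ℤ) (Z Zb' Z₀ Zb₀ b : Form1 d (Tau 𝔸)) (L : ℕ) (μ : Fin d) (y : Fin d → ℤ) :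
    MjetLAt 𝕜 ρ Z Zb' Z₀ Zb₀ (fun κ x => τ₁ * b κ x) L μ y = c01 (MσLAt 𝕜 ρ Z Zb' Z₀ Zb₀ b L μ y) := by
  rw [MjetLAt_eq_c11_MσLAt, MσLAt_mul_central τ₁ τ₁_comm, c11_τ₁_mul]

/-- [folklore] … for `τ₂`: `Mjet(τ₂·b) = c10 Mσ(b)`. -/
theorem MjetLAt_τ₂_mul (ρ : Fin d → ℤ) (Z Zb' Z₀ Zb₀ b : Form1 d (Tau 𝔸)) (L : ℕ) (μ : Fin d) (y : Fin d → ℤ) :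
    MjetLAt 𝕜 ρ Z Zb' Z₀ Zb₀ (fun κ x => τ₂ * b κ x) L μ y = c10 (MσLAt 𝕜 ρ Z Zb' Z₀ Zb₀ b L μ y) := by
  rw [MjetLAt_eq_c11_MσLAt, MσLAt_mul_central τ₂ τ₂_comm, c11_τ₂_mul]

/-- [folklore] … for `τ₁τ₂`: `Mjet(τ₁τ₂·b) = c00 Mσ(b)`. -/
theorem MjetLAt_τ12_mul (ρ : Fin d → ℤ) (Z Zb' Z₀ Zb₀ b : Form1 d (Tau 𝔸)) (L : ℕ) (μ : Fin d) (y : Fin d → ℤ) :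
    MjetLAt 𝕜 ρ Z Zb' Z₀ Zb₀ (fun κ x => τ12 * b κ x) L μ y = c00 (MσLAt 𝕜 ρ Z Zb' Z₀ Zb₀ b L μ y) := by
  rw [MjetLAt_eq_c11_MσLAt, MσLAt_mul_central τ12 τ12_comm, c11_τ12_mul]

/-- [folklore] `𝕜`-HOMOGENEITY of the σ-jet in the background letter. -/
theorem MσLAt_smul (r : 𝕜) (ρ : Fin d → ℤ) (Z Zb' Z₀ Zb₀ b : Form1 d (Tau 𝔸)) (L : ℕ) (μ : Fin d) (y : Fin d → ℤ) :
    MσLAt 𝕜 ρ Z Zb' Z₀ Zb₀ (r • b) L μ y = r • MσLAt 𝕜 ρ Z Zb' Z₀ Zb₀ b L μ y := by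
  have h := MσLAt_mul_central (𝕜 := 𝕜) (algebraMap 𝕜 (Tau 𝔸) r) (fun t => Algebra.commutes r t) ρ Z Zb' Z₀ Zb₀ b L μ y
  simp only [← Algebra.smul_def] at h
  exact h

/-! ## §2 Additivity -/

/-- [folklore] The doubled forward letter in `Rho 𝔸 [ρ′]`: `Z·(1 + ρ b₁ + ρ′ b₂)`. -/
def GmL2 (Z b₁ b₂ : Form1 d (Tau 𝔸)) : Form1 d (DualNumber (Rho 𝔸)) :=
  fun κ x => dmk (GmL Z b₁ κ x) (dmk (Z κ x * b₂ κ x) 0)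

/-- [folklore] The doubled backward letter `(1 − ρ b₁ − ρ′ b₂)·Z̄′`. -/
def GmbL2 (Zb' b₁ b₂ : Form1 d (Tau 𝔸)) : Form1 d (DualNumber (Rho 𝔸)) :=
  fun κ x => dmk (GmbL Zb' b₁ κ x) (dmk (-(b₂ κ x * Zb' κ x)) 0)

section TwoLetters

variable (Z Zb' b₁ b₂ : Form1 d (Tau 𝔸)) (κ : Fin d) (x : Fin d → ℤ)

omit [Algebra 𝕜 𝔸] in
/-- [folklore] Components of the doubled letters. -/
@[simp] theorem fst_GmL2 : (GmL2 Z b₁ b₂ κ x).fst = GmL Z b₁ κ x := rfl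
omit [Algebra 𝕜 𝔸] in
/-- [folklore] -/
@[simp] theorem snd_GmL2 : (GmL2 Z b₁ b₂ κ x).snd = dmk (Z κ x * b₂ κ x) 0 := rfl
omit [Algebra 𝕜 𝔸] in
/-- [folklore] -/
@[simp] theorem fst_GmbL2 : (GmbL2 Zb' b₁ b₂ κ x).fst = GmbL Zb' b₁ κ x := rfl
omit [Algebra 𝕜 𝔸] in
/-- [folklore] -/
@[simp] theorem snd_GmbL2 : (GmbL2 Zb' b₁ b₂ κ x).snd = dmk (-(b₂ κ x * Zb' κ x)) 0 := rfl

end TwoLetters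

set_option synthInstance.maxHeartbeats 200000 in
set_option maxHeartbeats 1600000 in
/-- [folklore] **JOINT ADDITIVITY OF THE TWO-BACKGROUND σ-JET IN THE PAIR (numerator background, reference background)** (node 12's
three-map proof: kill `ρ′`, kill `ρ`, merge `ρ′ = ρ`, on doubled letters in numerator AND reference). -/
theorem MσGAt_add₂ (ρ : Fin d → ℤ) (Z Zb' b₁ b₂ Z₀ Zb₀ c₁ c₂ : Form1 d (Tau 𝔸)) (L : ℕ) (μ : Fin d) (y : Fin d → ℤ) :
    MσGAt 𝕜 ρ Z Zb' (b₁ + b₂) Z₀ Zb₀ (c₁ + c₂) L μ y = MσGAt 𝕜 ρ Z Zb' b₁ Z₀ Zb₀ c₁ L μ y + MσGAt 𝕜 ρ Z Zb' b₂ Z₀ Zb₀ c₂ L μ y := by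
  have h2 : ∀ (Z b₁ b₂ : Form1 d (Tau 𝔸)) κ x,
      mapDual (TrivSqZeroExt.fstHom 𝕜 (Tau 𝔸) (Tau 𝔸)) (GmL2 Z b₁ b₂ κ x) = GmL Z b₂ κ x :=
    fun Z b₁ b₂ κ x => TrivSqZeroExt.ext (by simp) (by simp)
  have h2b : ∀ (Zb' b₁ b₂ : Form1 d (Tau 𝔸)) κ x,
      mapDual (TrivSqZeroExt.fstHom 𝕜 (Tau 𝔸) (Tau 𝔸)) (GmbL2 Zb' b₁ b₂ κ x) = GmbL Zb' b₂ κ x :=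
    fun Zb' b₁ b₂ κ x => TrivSqZeroExt.ext (by simp) (by simp)
  have h3 : ∀ (Z b₁ b₂ : Form1 d (Tau 𝔸)) κ x, mergeDual (𝕜 := 𝕜) (GmL2 Z b₁ b₂ κ x) = GmL Z (b₁ + b₂) κ x :=
    fun Z b₁ b₂ κ x => TrivSqZeroExt.ext (by simp) (by simp [mul_add])
  have h3b : ∀ (Zb' b₁ b₂ : Form1 d (Tau 𝔸)) κ x, mergeDual (𝕜 := 𝕜) (GmbL2 Zb' b₁ b₂ κ x) = GmbL Zb' (b₁ + b₂) κ x :=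
    fun Zb' b₁ b₂ κ x => TrivSqZeroExt.ext (by simp) (by
      rw [snd_mergeDual, fst_GmbL2, snd_GmbL2, snd_GmbL, fst_dmk, snd_GmbL, Pi.add_apply, Pi.add_apply, add_mul, neg_add])
  unfold MσGAt PhiMLAt
  have k1 := congrArg TrivSqZeroExt.snd (map_logT (TrivSqZeroExt.fstHom 𝕜 (Rho 𝔸) (Rho 𝔸))
    (PhiGAt 𝕜 ρ (GmL2 Z b₁ b₂) (GmbL2 Zb' b₁ b₂) L μ y * invT (PhiGAt 𝕜 ρ (GmL2 Z₀ c₁ c₂) (GmbL2 Zb₀ c₁ c₂) L μ y)))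
  simp only [map_mul, map_invT, map_PhiGAt, TrivSqZeroExt.fstHom_apply, fst_GmL2, fst_GmbL2] at k1
  have k2 := congrArg TrivSqZeroExt.snd (map_logT (mapDual (TrivSqZeroExt.fstHom 𝕜 (Tau 𝔸) (Tau 𝔸)))
    (PhiGAt 𝕜 ρ (GmL2 Z b₁ b₂) (GmbL2 Zb' b₁ b₂) L μ y * invT (PhiGAt 𝕜 ρ (GmL2 Z₀ c₁ c₂) (GmbL2 Zb₀ c₁ c₂) L μ y)))
  simp only [map_mul, map_invT, map_PhiGAt, h2, h2b, snd_mapDual, TrivSqZeroExt.fstHom_apply] at k2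
  have k3 := congrArg TrivSqZeroExt.snd (map_logT (mergeDual (𝕜 := 𝕜))
    (PhiGAt 𝕜 ρ (GmL2 Z b₁ b₂) (GmbL2 Zb' b₁ b₂) L μ y * invT (PhiGAt 𝕜 ρ (GmL2 Z₀ c₁ c₂) (GmbL2 Zb₀ c₁ c₂) L μ y)))
  simp only [map_mul, map_invT, map_PhiGAt, h3, h3b, snd_mergeDual] at k3
  exact k3.symm.trans (congrArg₂ HAdd.hAdd k1 k2)

/-- [folklore] **THE REFERENCE SHIFT**: a background correction `D` in the NUMERATOR only adds its un-normalised σ-jet —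
`MσGAt … (c + D) … c = MσLAt … c + MσGAt … D … 0`. -/
theorem MσGAt_eq_MσLAt_add (ρ : Fin d → ℤ) (Z Zb' Z₀ Zb₀ c D : Form1 d (Tau 𝔸)) (L : ℕ) (μ : Fin d) (y : Fin d → ℤ) :
    MσGAt 𝕜 ρ Z Zb' (c + D) Z₀ Zb₀ c L μ y = MσLAt 𝕜 ρ Z Zb' Z₀ Zb₀ c L μ y + MσGAt 𝕜 ρ Z Zb' D Z₀ Zb₀ 0 L μ y := by
  have h := MσGAt_add₂ (𝕜 := 𝕜) ρ Z Zb' c D Z₀ Zb₀ c 0 L μ y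
  rw [add_zero] at h
  rw [MσLAt_eq_MσGAt]; exact h

/-- [folklore] ADDITIVITY of the common-background σ-jet in the background letter. -/
theorem MσLAt_add (ρ : Fin d → ℤ) (Z Zb' Z₀ Zb₀ b₁ b₂ : Form1 d (Tau 𝔸)) (L : ℕ) (μ : Fin d) (y : Fin d → ℤ) :
    MσLAt 𝕜 ρ Z Zb' Z₀ Zb₀ (b₁ + b₂) L μ y = MσLAt 𝕜 ρ Z Zb' Z₀ Zb₀ b₁ L μ y + MσLAt 𝕜 ρ Z Zb' Z₀ Zb₀ b₂ L μ y := by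
  rw [MσLAt_eq_MσGAt, MσLAt_eq_MσGAt, MσLAt_eq_MσGAt]; exact MσGAt_add₂ ρ Z Zb' b₁ b₂ Z₀ Zb₀ b₁ b₂ L μ y

/-- [folklore] ADDITIVITY of the un-normalised σ-jet in the background letter. -/
theorem MσGAt_add_zero (ρ : Fin d → ℤ) (Z Zb' b₁ b₂ Z₀ Zb₀ : Form1 d (Tau 𝔸)) (L : ℕ) (μ : Fin d) (y : Fin d → ℤ) :
    MσGAt 𝕜 ρ Z Zb' (b₁ + b₂) Z₀ Zb₀ 0 L μ y = MσGAt 𝕜 ρ Z Zb' b₁ Z₀ Zb₀ 0 L μ y + MσGAt 𝕜 ρ Z Zb' b₂ Z₀ Zb₀ 0 L μ y := by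
  have h := MσGAt_add₂ (𝕜 := 𝕜) ρ Z Zb' b₁ b₂ Z₀ Zb₀ 0 0 L μ y
  rw [add_zero] at h
  exact h

/-- [folklore] The two-background σ-jet of zero backgrounds vanishes. -/
@[simp] theorem MσGAt_zero_zero (ρ : Fin d → ℤ) (Z Zb' Z₀ Zb₀ : Form1 d (Tau 𝔸)) (L : ℕ) (μ : Fin d) (y : Fin d → ℤ) :
    MσGAt 𝕜 ρ Z Zb' (0 : Form1 d (Tau 𝔸)) Z₀ Zb₀ 0 L μ y = 0 := by
  have h := MσGAt_add₂ (𝕜 := 𝕜) ρ Z Zb' (0 : Form1 d (Tau 𝔸)) 0 Z₀ Zb₀ 0 0 L μ y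
  simp only [add_zero] at h
  exact left_eq_add.mp h

/-- [folklore] The σ-jet of the zero background vanishes. -/
@[simp] theorem MσLAt_zero (ρ : Fin d → ℤ) (Z Zb' Z₀ Zb₀ : Form1 d (Tau 𝔸)) (L : ℕ) (μ : Fin d) (y : Fin d → ℤ) :
    MσLAt 𝕜 ρ Z Zb' Z₀ Zb₀ (0 : Form1 d (Tau 𝔸)) L μ y = 0 := by
  rw [MσLAt_eq_MσGAt]; exact MσGAt_zero_zero ρ Z Zb' Z₀ Zb₀ L μ y

/-- [folklore] The σ-jet is odd in the background letter. -/
theorem MσLAt_neg (ρ : Fin d → ℤ) (Z Zb' Z₀ Zb₀ b : Form1 d (Tau 𝔸)) (L : ℕ) (μ : Fin d) (y : Fin d → ℤ) :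
    MσLAt 𝕜 ρ Z Zb' Z₀ Zb₀ (-b) L μ y = -MσLAt 𝕜 ρ Z Zb' Z₀ Zb₀ b L μ y := by
  have h := MσLAt_add (𝕜 := 𝕜) ρ Z Zb' Z₀ Zb₀ b (-b) L μ y
  rw [add_neg_cancel, MσLAt_zero] at h
  exact (neg_eq_of_add_eq_zero_right h.symm).symm

/-- [folklore] -/
theorem MσLAt_sub (ρ : Fin d → ℤ) (Z Zb' Z₀ Zb₀ b₁ b₂ : Form1 d (Tau 𝔸)) (L : ℕ) (μ : Fin d) (y : Fin d → ℤ) :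
    MσLAt 𝕜 ρ Z Zb' Z₀ Zb₀ (b₁ - b₂) L μ y = MσLAt 𝕜 ρ Z Zb' Z₀ Zb₀ b₁ L μ y - MσLAt 𝕜 ρ Z Zb' Z₀ Zb₀ b₂ L μ y := by
  rw [sub_eq_add_neg, MσLAt_add, MσLAt_neg, ← sub_eq_add_neg]

/-- [folklore] Finite additivity. -/
theorem MσLAt_sum {ι' : Type*} (s : Finset ι') (b : ι' → Form1 d (Tau 𝔸)) (ρ : Fin d → ℤ) (Z Zb' Z₀ Zb₀ : Form1 d (Tau 𝔸))
    (L : ℕ) (μ : Fin d) (y : Fin d → ℤ) :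
    MσLAt 𝕜 ρ Z Zb' Z₀ Zb₀ (∑ i ∈ s, b i) L μ y = ∑ i ∈ s, MσLAt 𝕜 ρ Z Zb' Z₀ Zb₀ (b i) L μ y := by
  classical
  induction s using Finset.induction_on with
  | empty => simp
  | insert i s hi ih => rw [Finset.sum_insert hi, Finset.sum_insert hi, MσLAt_add, ih]

/-- [folklore] ADDITIVITY of leaf-05's `MjetLAt` in the background letter. -/
theorem MjetLAt_add (ρ : Fin d → ℤ) (Z Zb' Z₀ Zb₀ b₁ b₂ : Form1 d (Tau 𝔸)) (L : ℕ) (μ : Fin d) (y : Fin d → ℤ) :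
    MjetLAt 𝕜 ρ Z Zb' Z₀ Zb₀ (b₁ + b₂) L μ y = MjetLAt 𝕜 ρ Z Zb' Z₀ Zb₀ b₁ L μ y + MjetLAt 𝕜 ρ Z Zb' Z₀ Zb₀ b₂ L μ y := by
  rw [MjetLAt_eq_c11_MσLAt, MjetLAt_eq_c11_MσLAt, MjetLAt_eq_c11_MσLAt, MσLAt_add, c11_add]

/-- [folklore] -/
@[simp] theorem MjetLAt_zero (ρ : Fin d → ℤ) (Z Zb' Z₀ Zb₀ : Form1 d (Tau 𝔸)) (L : ℕ) (μ : Fin d) (y : Fin d → ℤ) :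
    MjetLAt 𝕜 ρ Z Zb' Z₀ Zb₀ (0 : Form1 d (Tau 𝔸)) L μ y = 0 := by
  rw [MjetLAt_eq_c11_MσLAt, MσLAt_zero]; rfl

/-- [folklore] -/
theorem MjetLAt_neg (ρ : Fin d → ℤ) (Z Zb' Z₀ Zb₀ b : Form1 d (Tau 𝔸)) (L : ℕ) (μ : Fin d) (y : Fin d → ℤ) :
    MjetLAt 𝕜 ρ Z Zb' Z₀ Zb₀ (-b) L μ y = -MjetLAt 𝕜 ρ Z Zb' Z₀ Zb₀ b L μ y := by
  rw [MjetLAt_eq_c11_MσLAt, MjetLAt_eq_c11_MσLAt, MσLAt_neg, c11_neg]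

/-- [folklore] -/
theorem MjetLAt_sum {ι' : Type*} (s : Finset ι') (b : ι' → Form1 d (Tau 𝔸)) (ρ : Fin d → ℤ) (Z Zb' Z₀ Zb₀ : Form1 d (Tau 𝔸))
    (L : ℕ) (μ : Fin d) (y : Fin d → ℤ) :
    MjetLAt 𝕜 ρ Z Zb' Z₀ Zb₀ (∑ i ∈ s, b i) L μ y = ∑ i ∈ s, MjetLAt 𝕜 ρ Z Zb' Z₀ Zb₀ (b i) L μ y := by
  classical
  induction s using Finset.induction_on with
  | empty => simp
  | insert i s hi ih => rw [Finset.sum_insert hi, Finset.sum_insert hi, MjetLAt_add, ih]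

/-! ## §3 Node 12b's mixed jet `MjetAt` in the background `B` -/

omit [Algebra 𝕜 𝔸] in
/-- [folklore] `upF` is additive. -/
theorem upF_add (B₁ B₂ : Form1 d 𝔸) : upF (B₁ + B₂) = upF B₁ + upF B₂ := by
  funext κ x; exact ext4 (by simp) (by simp) (by simp) (by simp)

omit [Algebra 𝕜 𝔸] in
/-- [folklore] `upF` is odd. -/
theorem upF_neg (B : Form1 d 𝔸) : upF (-B) = -upF B := by
  funext κ x; exact ext4 (by simp) (by simp) (by simp) (by simp)

/-- [folklore] **ADDITIVITY OF NODE 12b's ROOTED MIXED JET IN THE BACKGROUND.** -/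
theorem MjetAt_add_B (ρ : Fin d → ℤ) (W V B₁ B₂ : Form1 d 𝔸) (L : ℕ) (μ : Fin d) (y : Fin d → ℤ) :
    MjetAt 𝕜 ρ W V (B₁ + B₂) L μ y = MjetAt 𝕜 ρ W V B₁ L μ y + MjetAt 𝕜 ρ W V B₂ L μ y := by
  rw [MjetAt_eq_MjetLAt, MjetAt_eq_MjetLAt, MjetAt_eq_MjetLAt, upF_add, MjetLAt_add]

/-- [folklore] -/
theorem MjetAt_neg_B (ρ : Fin d → ℤ) (W V B : Form1 d 𝔸) (L : ℕ) (μ : Fin d) (y : Fin d → ℤ) :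
    MjetAt 𝕜 ρ W V (-B) L μ y = -MjetAt 𝕜 ρ W V B L μ y := by
  rw [MjetAt_eq_MjetLAt, MjetAt_eq_MjetLAt, upF_neg, MjetLAt_neg]

/-- [folklore] -/
theorem MjetAt_sub_B (ρ : Fin d → ℤ) (W V B₁ B₂ : Form1 d 𝔸) (L : ℕ) (μ : Fin d) (y : Fin d → ℤ) :
    MjetAt 𝕜 ρ W V (B₁ - B₂) L μ y = MjetAt 𝕜 ρ W V B₁ L μ y - MjetAt 𝕜 ρ W V B₂ L μ y := by
  rw [sub_eq_add_neg, MjetAt_add_B, MjetAt_neg_B, ← sub_eq_add_neg]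

/-- [folklore] Finite additivity of `MjetAt` in the background. -/
theorem MjetAt_sum_B {ι' : Type*} (s : Finset ι') (B : ι' → Form1 d 𝔸) (ρ : Fin d → ℤ) (W V : Form1 d 𝔸) (L : ℕ) (μ : Fin d)
    (y : Fin d → ℤ) :
    MjetAt 𝕜 ρ W V (∑ i ∈ s, B i) L μ y = ∑ i ∈ s, MjetAt 𝕜 ρ W V (B i) L μ y := by
  classical
  induction s using Finset.induction_on with
  | empty => simp [AveragingMixedJetTables.MjetAt_B_zero]
  | insert i s hi ih => rw [Finset.sum_insert hi, Finset.sum_insert hi, MjetAt_add_B, ih]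

end Summit.QuantumFields.BalabanUV.Beta.RootedMixedJetLinear
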